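import Literature.AlgebraicTopology.CharacteristicClasses.TautologicalEulerClass
import Literature.AlgebraicTopology.CharacteristicClasses.ProjectiveBundleSplittingIso
import HarnessLib

/-!
# The line subbundle `λ ⊆ q^*ξ` over `P(ξ)`: inclusion, local comparison with `γ¹(F)`, and
the local form of its Euler class

D. Husemoller, *Fibre Bundles* (3rd ed. 1994), Ch. 17 §2 (the line bundle `λ_ξ` over `E(Pξ)` and
the class `a_ξ`; "restricted to a fibre `ℙ(F)` it is the canonical line bundle") and Prop. 3.3
(naturality). For a complex vector bundle `ξ = E` over `B`, `P(E) = E.Proj`, the line bundle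
`λ = E.lineBundle k₀` (`ProjectiveBundleSplitting`) and a local trivialisation `e_i` of `E`:

* `lineIncl`: the inclusion of total spaces `λ → E`, `(m, c) ↦ c • u(m)` (`u(m)` the adapted
  spanning vector of the line `m`), is continuous;
* over `K ⊆ U_i`: the map `ℓ_K : P(E)_K → ℙ(F)`, `m ↦ ℙ(e_i) m`, and the bundle map
  `Λ : λ|_{P(E)_K} → γ¹(F)` over it, `c ↦ e_i(c • u(m))`, a fibrewise isomorphism with continuous
  total map (`lineTautEquiv`, `continuous_lineTautMap`);
* **`map_incl_lineEuler`**: for `K` CLOSED (so that `P(E)_K` is paracompact) and `B` paracompact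
  Hausdorff, `e(λ)|_{P(E)_K} = ℓ_K^* e(γ¹(F))` — naturality of the Euler class under pull-back
  (`eulerClass_pullback`) and under the bundle map `Λ` (`eulerClass_bundleMap`).

This is the local input of the Leray–Hirsch theorem for `P(E) → B`. Everything is proved; no named facts.

## References

* D. Husemoller, *Fibre Bundles*, GTM 20, Springer 1994, Ch. 17 §2, Prop. 3.3. [HusemollerFibreBundles1994]
-/

noncomputable section

open CategoryTheory Function Set Bundle Module Literature.AlgebraicTopology.SingularHomology
open scoped LinearAlgebra.Projectivization

namespace Literature.AlgebraicTopology.CharacteristicClasses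

open ComplexVectorBundle

/-! ### Continuous maps into `E(γ¹(V))` -/

section TautMk

variable {V : Type} [NormedAddCommGroup V] [NormedSpace ℂ V] [FiniteDimensional ℂ V] {X : Type} [TopologicalSpace X]

/-- **A map `x ↦ (ℓ(x), v(x))` into `E(γ¹(V))` is continuous when `ℓ` and `v` are.** [folklore] -/
theorem continuous_tautMk (ℓ : X → ℙ ℂ V) (v : X → V) (hℓ : Continuous ℓ) (hv : Continuous v)
    (hmem : ∀ x, v x ∈ Projectivization.submodule (ℓ x)) :
    Continuous fun x ↦ (⟨ℓ x, ⟨v x, hmem x⟩⟩ : TotalSpace ℂ (tautFiber ℂ V)) := by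
  refine continuous_iff_continuousAt.2 fun x₀ ↦ ?_
  set e := trivializationAt ℂ (tautFiber ℂ V) (ℓ x₀)
  refine e.continuousAt_of_comp_left hℓ.continuousAt (mem_baseSet_trivializationAt ℂ (tautFiber ℂ V) _) ?_
  change ContinuousAt (fun x ↦ (ℓ x, chartFunctional ℂ V (ℓ x₀) (v x))) x₀
  exact (hℓ.prodMk ((chartFunctional ℂ V (ℓ x₀)).continuous.comp hv)).continuousAt

/-- **The line through a nonzero `w ∈ ℓ` is `ℓ`: `c ↦ c • w : ℂ ≃ ℓ`.** [folklore] -/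
def lineEquivOfMem (ℓ : ℙ ℂ V) (w : V) (hw : w ∈ Projectivization.submodule ℓ) (hw0 : w ≠ 0) :
    ℂ ≃L[ℂ] tautFiber ℂ V ℓ :=
  LinearEquiv.toContinuousLinearEquiv <|
    LinearEquiv.ofBijective (LinearMap.toSpanSingleton ℂ (tautFiber ℂ V ℓ) ⟨w, hw⟩)
      ⟨fun a b h ↦ smul_left_injective ℂ (show (⟨w, hw⟩ : tautFiber ℂ V ℓ) ≠ 0 from
          fun h0 ↦ hw0 (congrArg Subtype.val h0)) h,
        fun y ↦ by
          have h1 : Module.finrank ℂ (tautFiber ℂ V ℓ) = 1 := Projectivization.finrank_submodule ℓ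
          obtain ⟨c, hc⟩ := (finrank_eq_one_iff_of_nonzero' (⟨w, hw⟩ : tautFiber ℂ V ℓ)
            (fun h0 ↦ hw0 (congrArg Subtype.val h0))).1 h1 y
          exact ⟨c, hc⟩⟩

omit [FiniteDimensional ℂ V] in
/-- On vectors: `lineEquivOfMem ℓ w c = c • w`. [folklore] -/
@[simp]
theorem coe_lineEquivOfMem (ℓ : ℙ ℂ V) (w : V) (hw : w ∈ Projectivization.submodule ℓ)
    (hw0 : w ≠ 0) (c : ℂ) : ((lineEquivOfMem ℓ w hw hw0 c : tautFiber ℂ V ℓ) : V) = c • w := rfl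

end TautMk

/-! ### The inclusion `λ → E` -/

section Line

variable {B : Type} [TopologicalSpace B] (E : ComplexVectorBundle.{0, 0} B) (k₀ : Fin E.rank)

namespace ComplexVectorBundle

/-- The adapted spanning vector spans the line: `[u_α(m)] = m`. [folklore] -/
theorem mk_lineVecIn {α : E.FrameIndex} {m : E.Proj} (hm : m ∈ E.chartSet k₀ α) :
    Projectivization.mk ℂ (E.lineVecIn k₀ α m) (lineVecIn_ne_zero hm) = m.2 := by
  apply Projectivization.map_injective (((E.adaptedFrame α m.proj : E.E m.proj →L[ℂ] E.F) : E.E m.proj →ₗ[ℂ] E.F))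
    (E.adaptedFrame α m.proj).injective
  rw [Projectivization.map_mk]
  change Projectivization.mk ℂ (E.adaptedFrame α m.proj (E.lineVecIn k₀ α m)) _ = E.lineIn α m
  calc Projectivization.mk ℂ (E.adaptedFrame α m.proj (E.lineVecIn k₀ α m)) _
      = Projectivization.mk ℂ (E.lineRep k₀ α m) (lineRep_ne_zero hm) := by
        congr 1; exact adaptedFrame_lineVecIn α m
    _ = E.lineIn α m := mk_lineRep hm

/-- The adapted spanning vector lies on the line: `u_α(m) ∈ m`. [folklore] -/
theorem lineVecIn_mem {α : E.FrameIndex} {m : E.Proj} (hm : m ∈ E.chartSet k₀ α) :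
    E.lineVecIn k₀ α m ∈ Projectivization.submodule m.2 := by
  rw [← E.mk_lineVecIn k₀ hm, Projectivization.submodule_mk]
  exact Submodule.mem_span_singleton_self _

/-- **The vector of `E` represented by a point of `λ`**: `(m, c) ↦ c • u(m)`, `u(m)` the spanning
vector adapted to the distinguished chart at `m`. [cite: HusemollerFibreBundles1994, Ch. 17 §2] -/
def lineBundleVec (p : TotalSpace (E.lineBundle k₀).F (E.lineBundle k₀).E) : E.E p.proj.proj :=
  (show ℂ from p.2) • E.lineVecIn k₀ (E.chartAt k₀ p.proj) p.proj

/-- **The inclusion of total spaces `λ → E`.** [cite: HusemollerFibreBundles1994, Ch. 17 §2] -/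
def lineIncl (p : TotalSpace (E.lineBundle k₀).F (E.lineBundle k₀).E) : TotalSpace E.F E.E := ⟨p.proj.proj, E.lineBundleVec k₀ p⟩

/-- In any chart `α` containing `m`: `c' • u_{α(m)}(m) = c • u_α(m)` for `c' = g_{α,α(m)}(m) c`. [folklore] -/
theorem coordChange_smul_lineVecIn {α : E.FrameIndex} {m : E.Proj} (hα : m ∈ E.chartSet k₀ α) (c : ℂ) :
    ((E.lineCore k₀).coordChange α (E.chartAt k₀ m) m c) • E.lineVecIn k₀ (E.chartAt k₀ m) m = c • E.lineVecIn k₀ α m := by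
  rw [lineCore_coordChange_apply, lineVecIn_eq_smul hα (E.mem_chartSet_chartAt k₀ m), smul_smul, mul_comm]

/-- **`λ → E` is continuous.** In the chart `α = α(m₀)` of `λ` and `e_{b₀}` of `E` it reads
`(m, c) ↦ c • e_{b₀}(u_α(m))`. [cite: HusemollerFibreBundles1994, Ch. 17 §2] -/
theorem continuous_lineIncl : Continuous (E.lineIncl k₀) := by
  refine continuous_totalSpace_map (F₁ := (E.lineBundle k₀).F) (F₂ := E.F) (E₁ := (E.lineBundle k₀).E) (E₂ := E.E)
    (g := (TotalSpace.proj : E.Proj → B)) (continuous_projProj ℂ E.F E.E)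
    (fun m (c : (E.lineBundle k₀).E m) ↦ (show ℂ from c) • E.lineVecIn k₀ (E.chartAt k₀ m) m) fun p ↦ ?_
  obtain ⟨m₀, c₀⟩ := p
  set α := E.chartAt k₀ m₀ with hαdef
  have hm₀ : m₀ ∈ E.chartSet k₀ α := E.mem_chartSet_chartAt k₀ m₀
  set e := E.triv m₀.proj with hedef
  have hb₀ : m₀.proj ∈ e.baseSet := FiberBundle.mem_baseSet_trivializationAt' m₀.proj
  -- the local expression, valid on `chartSet α ∩ q⁻¹(e.baseSet)`
  have hev : ∀ q : E.Proj × (E.lineBundle k₀).F, q.1 ∈ E.chartSet k₀ α → q.1.proj ∈ e.baseSet →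
      (e (E.lineIncl k₀ ((trivializationAt (E.lineBundle k₀).F (E.lineBundle k₀).E m₀).toPartialEquiv.symm q))).2 =
      (show ℂ from q.2) • (e ⟨q.1.proj, E.lineVecIn k₀ α q.1⟩).2 := by
    rintro ⟨m, c⟩ hm hb
    have hsymm : (trivializationAt (E.lineBundle k₀).F (E.lineBundle k₀).E m₀).toPartialEquiv.symm (m, c) =
        ⟨m, (E.lineCore k₀).coordChange α (E.chartAt k₀ m) m c⟩ := by
      have h1 := (trivializationAt (E.lineBundle k₀).F (E.lineBundle k₀).E m₀).mk_symm (b := m) hm c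
      have h2 : (trivializationAt (E.lineBundle k₀).F (E.lineBundle k₀).E m₀).symm m c =
          (E.lineCore k₀).coordChange α (E.chartAt k₀ m) m c :=
        (E.lineCore k₀).localTriv_symm_apply (i := α) hm c
      rw [h2] at h1
      exact h1.symm
    rw [hsymm]
    change (e ⟨m.proj, ((E.lineCore k₀).coordChange α (E.chartAt k₀ m) m c) • E.lineVecIn k₀ (E.chartAt k₀ m) m⟩).2 = _
    rw [coordChange_smul_lineVecIn E k₀ hm, (e.linear ℂ hb).map_smul]
  have hopen : IsOpen {q : E.Proj × (E.lineBundle k₀).F | q.1 ∈ E.chartSet k₀ α ∧ q.1.proj ∈ e.baseSet} :=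
    ((isOpen_chartSet (E := E) (k₀ := k₀) α).inter (e.open_baseSet.preimage (continuous_projProj ℂ E.F E.E))).preimage continuous_fst
  have hq₀ : (trivializationAt (E.lineBundle k₀).F (E.lineBundle k₀).E m₀ ⟨m₀, c₀⟩).1 = m₀ :=
    (trivializationAt (E.lineBundle k₀).F (E.lineBundle k₀).E m₀).coe_fst
      (FiberBundle.mem_trivializationAt_proj_source (x := (⟨m₀, c₀⟩ : TotalSpace (E.lineBundle k₀).F (E.lineBundle k₀).E)))
  have hmem : (trivializationAt (E.lineBundle k₀).F (E.lineBundle k₀).E m₀ ⟨m₀, c₀⟩) ∈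
      {q : E.Proj × (E.lineBundle k₀).F | q.1 ∈ E.chartSet k₀ α ∧ q.1.proj ∈ e.baseSet} := by
    change (trivializationAt (E.lineBundle k₀).F (E.lineBundle k₀).E m₀ ⟨m₀, c₀⟩).1 ∈ E.chartSet k₀ α ∧
      (trivializationAt (E.lineBundle k₀).F (E.lineBundle k₀).E m₀ ⟨m₀, c₀⟩).1.proj ∈ e.baseSet
    rw [hq₀]
    exact ⟨hm₀, hb₀⟩
  refine ContinuousAt.congr (f := fun q : E.Proj × (E.lineBundle k₀).F ↦ (show ℂ from q.2) • (e ⟨q.1.proj, E.lineVecIn k₀ α q.1⟩).2) ?_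
    (Filter.eventuallyEq_of_mem (hopen.mem_nhds hmem) fun q hq ↦ (hev q hq.1 hq.2).symm)
  -- continuity of the local expression
  have hvec : ContinuousOn (fun m : E.Proj ↦ (e ⟨m.proj, E.lineVecIn k₀ α m⟩).2)
      (E.chartSet k₀ α ∩ TotalSpace.proj ⁻¹' e.baseSet) := by
    -- `u_α(m) = e_α⁻¹ (A⁻¹ v_α(m))`, so `e(u_α(m)) = g_{α.1, b₀}(q m) (A⁻¹ v_α(m))`
    have heq : ∀ m ∈ E.chartSet k₀ α ∩ TotalSpace.proj ⁻¹' e.baseSet,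
        (e ⟨m.proj, E.lineVecIn k₀ α m⟩).2 = (E.triv α.1).coordChangeL ℂ e m.proj (α.2.symm (E.lineRep k₀ α m)) := by
      rintro m ⟨hm, hb⟩
      rw [lineVecIn, adaptedFrame, ContinuousLinearEquiv.symm_trans_apply, linEquivAt_symm_apply _ hm.1,
        Trivialization.coordChangeL_apply' _ _ ⟨hm.1, hb⟩, (E.triv α.1).mk_symm hm.1]
    refine ContinuousOn.congr ?_ heq
    refine ContinuousOn.clm_apply (((continuousOn_coordChange ℂ (E.triv α.1) e)).comp (continuous_projProj ℂ E.F E.E).continuousOn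
      fun m hm ↦ ⟨hm.1.1, hm.2⟩) ?_
    exact (α.2.symm.continuous.comp_continuousOn (continuousOn_lineRep (E := E) (k₀ := k₀) α)).mono inter_subset_left
  have hcont : ContinuousAt (fun m : E.Proj ↦ (e ⟨m.proj, E.lineVecIn k₀ α m⟩).2) m₀ :=
    hvec.continuousAt (((isOpen_chartSet (E := E) (k₀ := k₀) α).inter (e.open_baseSet.preimage (continuous_projProj ℂ E.F E.E))).mem_nhds ⟨hm₀, hb₀⟩)
  rw [show trivializationAt (E.lineBundle k₀).F (E.lineBundle k₀).E m₀ ⟨m₀, c₀⟩ =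
      (m₀, (trivializationAt (E.lineBundle k₀).F (E.lineBundle k₀).E m₀ ⟨m₀, c₀⟩).2) from Prod.ext hq₀ rfl]
  have h1 : ContinuousAt (fun q : E.Proj × (E.lineBundle k₀).F ↦ (show ℂ from q.2))
      (m₀, (trivializationAt (E.lineBundle k₀).F (E.lineBundle k₀).E m₀ ⟨m₀, c₀⟩).2) := continuousAt_snd
  have h2 : ContinuousAt (fun q : E.Proj × (E.lineBundle k₀).F ↦ (e ⟨q.1.proj, E.lineVecIn k₀ α q.1⟩).2)
      (m₀, (trivializationAt (E.lineBundle k₀).F (E.lineBundle k₀).E m₀ ⟨m₀, c₀⟩).2) :=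
    ContinuousAt.comp (g := fun m : E.Proj ↦ (e ⟨m.proj, E.lineVecIn k₀ α m⟩).2) hcont continuousAt_fst
  exact h1.smul h2

/-- `q ∘ (λ → E) = q ∘ q_λ`. [folklore] -/
@[simp]
theorem lineIncl_proj (p : TotalSpace (E.lineBundle k₀).F (E.lineBundle k₀).E) : (E.lineIncl k₀ p).proj = p.proj.proj := rfl

end ComplexVectorBundle

end Line

/-! ### Over a chart `U_i` of `B`: the map to `ℙ(F)` and the bundle map `λ → γ¹(F)` -/

section Local

variable {B : Type} [TopologicalSpace B] (E : ComplexVectorBundle.{0, 0} B) (k₀ : Fin E.rank) (i : B) (K : Set B)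

namespace ComplexVectorBundle

/-- The frame `(i, 𝟙)`. [folklore] -/
abbrev stdFrame : E.FrameIndex := (i, ContinuousLinearEquiv.refl ℂ E.F)

/-- `P(E)_K = q⁻¹(K)`. [folklore] -/
abbrev ProjOver : Set E.Proj := TotalSpace.proj ⁻¹' K

/-- The inclusion `P(E)_K → P(E)`. [folklore] -/
abbrev inclOver : C(↥(E.ProjOver K), E.Proj) := subsetIncl (E.ProjOver K)

variable {K} (hK : K ⊆ (E.triv i).baseSet)

/-- **`ℓ_K : P(E)_K → ℙ(F)`, `m ↦ ℙ(e_i(q m)) m`.** [cite: HusemollerFibreBundles1994, Ch. 17 §2] -/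
def lineMapOver : C(↥(E.ProjOver K), ℙ ℂ E.F) :=
  ⟨fun p ↦ E.lineIn (E.stdFrame i) p.1,
    continuousOn_iff_continuous_restrict.1 ((continuousOn_lineIn (E.stdFrame i)).mono (preimage_mono hK))⟩

/-- `ℓ_K m = ℓ_{(i,𝟙)}(m)`. [folklore] -/
@[simp]
theorem lineMapOver_apply (p : ↥(E.ProjOver K)) : E.lineMapOver i hK p = E.lineIn (E.stdFrame i) p.1 := rfl

/-- **The vector `e_i(u(m)) ∈ F`** spanning `ℓ_K m`. [folklore] -/
def spanVec (m : E.Proj) : E.F := (E.triv i ⟨m.proj, E.lineVecIn k₀ (E.chartAt k₀ m) m⟩).2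

/-- It is `A_{(i,𝟙)}(u(m))`. [folklore] -/
theorem spanVec_eq {m : E.Proj} (hm : m.proj ∈ (E.triv i).baseSet) :
    E.spanVec k₀ i m = E.adaptedFrame (E.stdFrame i) m.proj (E.lineVecIn k₀ (E.chartAt k₀ m) m) := by
  rw [spanVec, adaptedFrame, ContinuousLinearEquiv.trans_apply, ContinuousLinearEquiv.refl_apply, linEquivAt_apply _ hm]

/-- It is nonzero. [folklore] -/
theorem spanVec_ne_zero {m : E.Proj} (hm : m.proj ∈ (E.triv i).baseSet) : E.spanVec k₀ i m ≠ 0 := by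
  rw [spanVec_eq E k₀ i hm]
  exact (E.adaptedFrame _ m.proj).injective.ne_iff' (map_zero _) |>.2 (lineVecIn_ne_zero (E.mem_chartSet_chartAt k₀ m))

/-- It spans the line `ℓ_K m`. [folklore] -/
theorem mk_spanVec {m : E.Proj} (hm : m.proj ∈ (E.triv i).baseSet) :
    Projectivization.mk ℂ (E.spanVec k₀ i m) (E.spanVec_ne_zero k₀ i hm) = E.lineIn (E.stdFrame i) m := by
  have h1 := congrArg (Projectivization.map
    (((E.adaptedFrame (E.stdFrame i) m.proj : E.E m.proj →L[ℂ] E.F) : E.E m.proj →ₗ[ℂ] E.F))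
    (E.adaptedFrame (E.stdFrame i) m.proj).injective) (E.mk_lineVecIn k₀ (E.mem_chartSet_chartAt k₀ m))
  rw [Projectivization.map_mk] at h1
  calc Projectivization.mk ℂ (E.spanVec k₀ i m) (E.spanVec_ne_zero k₀ i hm)
      = Projectivization.mk ℂ (E.adaptedFrame (E.stdFrame i) m.proj (E.lineVecIn k₀ (E.chartAt k₀ m) m))
          (by rw [← spanVec_eq E k₀ i hm]; exact E.spanVec_ne_zero k₀ i hm) := by
        congr 1; exact E.spanVec_eq k₀ i hm
    _ = E.lineIn (E.stdFrame i) m := h1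

/-- It lies on the line `ℓ_K m`. [folklore] -/
theorem spanVec_mem {m : E.Proj} (hm : m.proj ∈ (E.triv i).baseSet) :
    E.spanVec k₀ i m ∈ Projectivization.submodule (E.lineIn (E.stdFrame i) m) := by
  rw [← E.mk_spanVec k₀ i hm, Projectivization.submodule_mk]
  exact Submodule.mem_span_singleton_self _

/-- **The fibre isomorphisms `λ_m ≅ γ¹(F)_{ℓ_K m}`, `c ↦ c • e_i(u(m))`.** [cite: HusemollerFibreBundles1994, Ch. 17 §2] -/
def lineTautEquiv (p : ↥(E.ProjOver K)) : ((E.inclOver K : ↥(E.ProjOver K) → E.Proj) *ᵖ (E.lineBundle k₀).E) p ≃L[ℂ] tautFiber ℂ E.F (E.lineMapOver i hK p) :=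
  lineEquivOfMem _ (E.spanVec k₀ i p.1) (E.spanVec_mem k₀ i (hK p.2)) (E.spanVec_ne_zero k₀ i (hK p.2))

/-- The vector of the image: `Λ(p, c) = c • e_i(u(m)) = e_i(c • u(m))`. [folklore] -/
theorem coe_lineTautEquiv (p : ↥(E.ProjOver K)) (c : ((E.inclOver K : ↥(E.ProjOver K) → E.Proj) *ᵖ (E.lineBundle k₀).E) p) :
    ((E.lineTautEquiv k₀ i hK p c : tautFiber ℂ E.F _) : E.F) =
      (E.triv i (E.lineIncl k₀ (Pullback.lift (E.inclOver K) ⟨p, c⟩))).2 := by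
  change (show ℂ from c) • E.spanVec k₀ i p.1 = (E.triv i ⟨p.1.proj, (show ℂ from c) • E.lineVecIn k₀ (E.chartAt k₀ p.1) p.1⟩).2
  rw [((E.triv i).linear ℂ (hK p.2)).map_smul]
  rfl

/-- **The bundle map `Λ : λ|_{P(E)_K} → γ¹(F)` has a continuous total map.** [cite: HusemollerFibreBundles1994, Ch. 17 §2] -/
theorem continuous_lineTautMap : Continuous fun q : TotalSpace (E.lineBundle k₀).F ((E.inclOver K : ↥(E.ProjOver K) → E.Proj) *ᵖ (E.lineBundle k₀).E) ↦
    (⟨E.lineMapOver i hK q.proj, E.lineTautEquiv k₀ i hK q.proj q.2⟩ : TotalSpace ℂ (tautFiber ℂ E.F)) := by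
  have hv : Continuous fun q : TotalSpace (E.lineBundle k₀).F ((E.inclOver K : ↥(E.ProjOver K) → E.Proj) *ᵖ (E.lineBundle k₀).E) ↦
      (E.triv i (E.lineIncl k₀ (Pullback.lift (E.inclOver K) q))).2 := by
    have h1 : Continuous fun q : TotalSpace (E.lineBundle k₀).F ((E.inclOver K : ↥(E.ProjOver K) → E.Proj) *ᵖ (E.lineBundle k₀).E) ↦
        E.lineIncl k₀ (Pullback.lift (E.inclOver K) q) :=
      (E.continuous_lineIncl k₀).comp (Pullback.continuous_lift (E.lineBundle k₀).F (E.lineBundle k₀).E (E.inclOver K))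
    refine continuous_snd.comp ((E.triv i).continuousOn.comp_continuous h1 fun q ↦ ?_)
    rw [(E.triv i).mem_source]
    exact hK q.proj.2
  have h := continuous_tautMk (fun q : TotalSpace (E.lineBundle k₀).F ((E.inclOver K : ↥(E.ProjOver K) → E.Proj) *ᵖ (E.lineBundle k₀).E) ↦
      E.lineMapOver i hK q.proj)
    (fun q ↦ (E.triv i (E.lineIncl k₀ (Pullback.lift (E.inclOver K) q))).2)
    ((E.lineMapOver i hK).continuous.comp (FiberBundle.continuous_proj (E.lineBundle k₀).F
      ((E.inclOver K : ↥(E.ProjOver K) → E.Proj) *ᵖ (E.lineBundle k₀).E))) hv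
    (fun q ↦ by rw [← coe_lineTautEquiv]; exact (E.lineTautEquiv k₀ i hK q.proj q.2).2)
  convert h using 2 with q
  congr 1
  exact Subtype.ext (E.coe_lineTautEquiv k₀ i hK q.proj q.2)

/-! ### The local form of the Euler class of `λ` -/

variable [T2Space B] [ParacompactSpace B] (R : Type) [CommRing R]

omit [T2Space B] [ParacompactSpace B] in
/-- `dim_ℂ` of the model fibre of `λ` is `1`. [folklore] -/
theorem finrank_lineBundle : Module.finrank ℂ (E.lineBundle k₀).F = 1 := E.rank_lineBundle k₀

/-- **`x = e(λ) ∈ H²(P(E); R)`**, the Euler class of the line subbundle (Husemoller's `-a_ξ`).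
[cite: HusemollerFibreBundles1994, Ch. 17 §2] -/
def lineEuler (m : R) : singularCohomology R R E.Proj 2 :=
  eulerClass (E.lineBundle k₀).F (E.lineBundle k₀).E (E.finrank_lineBundle k₀) R m

/-- **The local form of `x`: `x|_{P(E)_K} = ℓ_K^* x_F`** for `K ⊆ U_i` closed (`x_F = e(γ¹(F))`).
[cite: HusemollerFibreBundles1994, Ch. 17 §2, Prop. 3.3] -/
theorem map_incl_lineEuler (hKc : IsClosed K) (m : R) :
    singularCohomology.map R R (E.inclOver K) 2 (E.lineEuler k₀ R m) =
      singularCohomology.map R R (E.lineMapOver i hK) 2 (tautEuler E.F R m) := by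
  haveI : ParacompactSpace ↥(E.ProjOver K) :=
    (hKc.preimage (continuous_projProj ℂ E.F E.E)).isClosedEmbedding_subtypeVal.paracompactSpace
  rw [lineEuler, ← eulerClass_pullback]
  exact eulerClass_bundleMap (E.lineBundle k₀).F ℂ ((E.inclOver K : ↥(E.ProjOver K) → E.Proj) *ᵖ (E.lineBundle k₀).E) (tautFiber ℂ E.F)
    (E.finrank_lineBundle k₀) (Module.finrank_self ℂ) R
    (g := E.lineMapOver i hK) (E.lineTautEquiv k₀ i hK) (E.continuous_lineTautMap k₀ i hK) m

end ComplexVectorBundle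

end Local

end Literature.AlgebraicTopology.CharacteristicClasses
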